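import Summits.CriticalPhenomena.PercolationContinuityZ3.Theorems.Transplant.KNCells2ChainBand
import Summits.CriticalPhenomena.PercolationContinuityZ3.Theorems.Transplant.KNCells2ChainAdvR
import HarnessLib

/-!
# The straight BAND run of route D″ v2, ROOTED variant (region `0` reaches only `ρ₀ = 3q + s₁ + 2R'` below the start box, so that a band chain
# may start right above forbidden territory — the pinned stub below a face-step contact, the wired root cube): the band-rectangle routes of
# `KNCells2ChainBand` read with the rooted regions `ChainPlanar.Adv.regionR` of `KNCells2ChainAdvR` (pure `Site 2` geometry)

builds on p205010 (kernel theorem, internal audit signed; external expert review pending) — nothing in this file uses p205010.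
Lane `prim-bschramm`, seat `prim-bschramm-p1` (gen 9; LEVEL 1 of D″, p2-g7 04:53:42Z); helper file (`--supports stmt-CriticalPhenomena-4575 --as helper`).
* `route_band_startR` (the start band route with the sharp lower level `−(3q + s + 2R')`);
* `Band.regionR` (:= `Adv.regionR`), **`Band.core_routeR`**, `Band.enlarge_core_subset_regionR`, `Band.core_succ_subset_regionR`,
  **`Band.regionR_subset_prism`** (all rooted regions inside `sBox a σ c (−ρ₀) (q + (N+1) s₁) ρ`).
[cite: KozmaNitzan2024, §4 Lemma 11 (pp. 22–23)]
-/

noncomputable section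

namespace Summit.CriticalPhenomena.PercolationContinuityZ3.Theorems

namespace Transplant

namespace ChainPlanar

open Literature.Probability.Percolation Literature.Probability.LatticeModels
open Literature.Probability.Percolation.KozmaNitzan
open Literature.Probability.Percolation.KozmaNitzan.Cells (oth oth_ne eq_oth_of_ne)

/-! ## §1 The start band route with the sharp lower level -/

/-- **BAND ROUTE FOR THE START STEP, rooted form**: as `route_band_start`, with the band rectangle inside
`sBox a σ c (−(3q + s + 2R')) (q + s) ρ` (its lowest level is `2·level(v) − q − s ≥ −3q − s − 2R'`). [cite: KozmaNitzan2024, §4 Lemma 11 (pp. 22–23)] -/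
theorem route_band_startR {a : Fin 2} {σ : ℤ} (hσ : σ = 1 ∨ σ = -1) (c : Site 2) {q q' s ρ : ℤ} {R' ℓ₀ WM : ℕ} (Wb : ℕ → ℕ)
    (hs : (R' : ℤ) + ℓ₀ ≤ s) (hWM : ∀ ℓ : ℕ, (ℓ : ℤ) ≤ 2 * q + s + R' → Wb ℓ ≤ WM) (hρ : q' + R' + WM ≤ ρ)
    {v : Site 2} (hv : v ∈ sBox a σ c (-q - R') (q + R') (q' + R')) :
    ∃ ℓ : ℕ, ℓ₀ ≤ ℓ ∧ (ℓ : ℤ) ≤ 2 * q + s + R' ∧ (ℓ : ℤ) = q + s - σ * (v a - c a) ∧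
      (∀ y : Site 2, |y a - v a| ≤ ℓ → |y (oth a) - v (oth a)| ≤ Wb ℓ → y ∈ sBox a σ c (-(Adv.ρ₀ q s R')) (q + s) ρ) ∧
      ∃ τ : ℤ, (τ = 1 ∨ τ = -1) ∧ ∀ y : Site 2, y a - v a = σ * ℓ → 0 ≤ τ * (y (oth a) - v (oth a)) →
        |y (oth a) - v (oth a)| ≤ Wb ℓ → y ∈ sBox a σ c (q + s) (q + s) (max (q' + R') WM) := by
  rw [mem_sBox_iff hσ] at hv
  obtain ⟨⟨hv1, hv2⟩, hvj⟩ := hv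
  have hvo := hvj (oth a) (oth_ne a)
  have hℓ0 : 0 ≤ q + s - σ * (v a - c a) := by omega
  obtain ⟨ℓ, hℓ⟩ : ∃ ℓ : ℕ, (ℓ : ℤ) = q + s - σ * (v a - c a) := ⟨_, Int.toNat_of_nonneg hℓ0⟩
  have hℓlo : (ℓ₀ : ℤ) ≤ ℓ := by omega
  have hℓhi : (ℓ : ℤ) ≤ 2 * q + s + R' := by omega
  have hW : ((Wb ℓ : ℕ) : ℤ) ≤ WM := by exact_mod_cast hWM ℓ hℓhi
  have hmaxl : q' + R' ≤ max (q' + R') (WM : ℤ) := le_max_left _ _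
  have hmaxr : (WM : ℤ) ≤ max (q' + R') (WM : ℤ) := le_max_right _ _
  refine ⟨ℓ, by exact_mod_cast hℓlo, hℓhi, hℓ, fun y hya hyo => ?_, ?_⟩
  · rw [mem_sBox_iff hσ, Adv.ρ₀]
    rw [abs_le] at hya hyo
    refine ⟨?_, fun j hj => ?_⟩
    · rcases hσ with rfl | rfl <;> constructor <;> linarith [hya.1, hya.2]
    · rw [eq_oth_of_ne hj]
      constructor <;> linarith [hyo.1, hyo.2, hvo.1, hvo.2]
  · refine ⟨if c (oth a) < v (oth a) then -1 else 1, by split_ifs <;> simp, fun y hya hτ hyo => ?_⟩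
    rw [mem_sBox_iff hσ]
    rw [abs_le] at hyo
    have hσσ : σ * σ = 1 := by rcases hσ with h | h <;> simp [h]
    refine ⟨?_, fun j hj => ?_⟩
    · have : σ * (y a - c a) = σ * (v a - c a) + ℓ := by
        have h1 : y a - c a = (v a - c a) + σ * ℓ := by linarith
        rw [h1, mul_add, ← mul_assoc, hσσ, one_mul]
      rw [this]; constructor <;> omega
    · rw [eq_oth_of_ne hj]
      by_cases hlt : c (oth a) < v (oth a)
      · rw [if_pos hlt] at hτ
        constructor <;> linarith [hyo.1, hyo.2, hvo.1, hvo.2]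
      · rw [if_neg hlt] at hτ
        push Not at hlt
        constructor <;> linarith [hyo.1, hyo.2, hvo.1, hvo.2]

/-! ## §2 The rooted band run -/

namespace Band

variable (q q' s₁ ρ : ℤ) (R' N WM : ℕ)

/-- **Region `k` of the rooted band run** (:= `Adv.regionR`): region `0` reaches only `ρ₀ = 3q + s₁ + 2R'` below the start box.
[cite: KozmaNitzan2024, §4 Lemma 11 (p. 22: the slabs of Ω)] -/
def regionR (a : Fin 2) (σ : ℤ) (c : Site 2) (k : ℕ) : Finset (Site 2) := Adv.regionR q s₁ ρ R' a σ c k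

variable {q q' s₁ ρ R' N WM} {ℓ₀ : ℕ} {Wb : ℕ → ℕ} {a : Fin 2} {σ : ℤ} (hσ : σ = 1 ∨ σ = -1) (c : Site 2)
  (h : BandOK q q' s₁ ρ R' ℓ₀ N WM Wb)
include hσ h

/-- **BAND ROUTES of the rooted band run** (`k ≤ N`): as `Band.core_route` with the band rectangle inside `regionR k`.
[cite: KozmaNitzan2024, §4 Lemma 11 (pp. 22–23)] -/
theorem core_routeR {k : ℕ} (hk : k ≤ N) {v : Site 2}
    (hv : v ∈ sBox a σ c (Adv.coreα q s₁ k - R') (Adv.coreβ q s₁ k + R') (coreW q' R' WM k + R')) :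
    ∃ ℓ : ℕ, ℓ₀ ≤ ℓ ∧ (ℓ : ℤ) ≤ 2 * q + s₁ + R' ∧ (ℓ : ℤ) = Adv.coreβ q s₁ (k + 1) - σ * (v a - c a) ∧
      (∀ y : Site 2, |y a - v a| ≤ ℓ → |y (oth a) - v (oth a)| ≤ Wb ℓ → y ∈ regionR q s₁ ρ R' a σ c k) ∧
      ∃ τ : ℤ, (τ = 1 ∨ τ = -1) ∧ ∀ y : Site 2, y a - v a = σ * ℓ → 0 ≤ τ * (y (oth a) - v (oth a)) →
        |y (oth a) - v (oth a)| ≤ Wb ℓ → y ∈ core q q' s₁ R' WM a σ c (k + 1) := by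
  by_cases hk0 : k = 0
  · subst hk0
    obtain ⟨⟨e0α, e0β, e0W⟩, eF⟩ := core_params (q := q) (q' := q') (s₁ := s₁) (R' := R') (WM := WM)
    have hq := h.hq; have hq' := h.hq'; have hs := h.hs; have hρ0 := h.hρ0; have hρ := h.hρ; have hWM := h.hWM
    have hR0 : (0 : ℤ) ≤ R' := by positivity
    have hW0 : (0 : ℤ) ≤ WM := by positivity
    have hNR : (0 : ℤ) ≤ (N : ℤ) * R' := by positivity
    obtain ⟨e1α, e1β, e1W⟩ := eF 1 le_rfl
    rw [e0α, e0β, e0W] at hv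
    obtain ⟨ℓ, hℓ0, hℓhi, hℓ, hrect, τ, hτ, hhalf⟩ := route_band_startR hσ c (q := q) (q' := q') (s := s₁) (ρ := ρ) (R' := R')
      (ℓ₀ := ℓ₀) (WM := WM) Wb hs hWM (by nlinarith) hv
    refine ⟨ℓ, hℓ0, hℓhi, by rw [e1β]; push_cast; linarith, fun y h1 h2 => ?_, τ, hτ, fun y h1 h2 h3 => ?_⟩
    · rw [regionR, Adv.regionR, if_pos rfl]; exact hrect y h1 h2
    · rw [core, e1α, e1β, e1W, w₁]
      have hy := hhalf y h1 h2 h3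
      push_cast
      refine sBox_mono hσ c (by linarith) (by linarith) ?_ hy
      exact max_le (by linarith) (by linarith)
  · obtain ⟨ℓ, hℓ0, hℓhi, hℓ, hrect, τ, hτ, hhalf⟩ := core_route hσ c h hk hv
    refine ⟨ℓ, hℓ0, hℓhi, hℓ, fun y h1 h2 => ?_, τ, hτ, hhalf⟩
    rw [regionR, Adv.regionR_of_ne_zero hk0]
    exact hrect y h1 h2

/-- **The `R'`-enlargement of core `k ≤ N` lies in the rooted region `k`.** [cite: KozmaNitzan2024, §4 Lemma 11 (p. 22)] -/
theorem enlarge_core_subset_regionR {k : ℕ} (hk : k ≤ N) :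
    sBox a σ c (Adv.coreα q s₁ k - R') (Adv.coreβ q s₁ k + R') (coreW q' R' WM k + R') ⊆ regionR q s₁ ρ R' a σ c k := by
  by_cases hk0 : k = 0
  · subst hk0
    obtain ⟨⟨e0α, e0β, e0W⟩, -⟩ := core_params (q := q) (q' := q') (s₁ := s₁) (R' := R') (WM := WM)
    have hq := h.hq; have hq' := h.hq'; have hs := h.hs; have hs2 := h.hs2; have hρ := h.hρ
    have hR0 : (0 : ℤ) ≤ R' := by positivity
    have hW0 : (0 : ℤ) ≤ WM := by positivity
    have hNR : (0 : ℤ) ≤ (N : ℤ) * R' := by positivity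
    rw [e0α, e0β, e0W, regionR, Adv.regionR, if_pos rfl, Adv.ρ₀]
    exact sBox_mono hσ c (by linarith) (by linarith) (by linarith)
  · rw [regionR, Adv.regionR_of_ne_zero hk0]
    exact enlarge_core_subset_region hσ c h hk

/-- **The next core lies in the rooted region `k`** (`k ≤ N`). [cite: KozmaNitzan2024, §4 Lemma 11 (p. 22)] -/
theorem core_succ_subset_regionR {k : ℕ} (hk : k ≤ N) : core q q' s₁ R' WM a σ c (k + 1) ⊆ regionR q s₁ ρ R' a σ c k := by
  by_cases hk0 : k = 0
  · subst hk0
    obtain ⟨-, eF⟩ := core_params (q := q) (q' := q') (s₁ := s₁) (R' := R') (WM := WM)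
    have hq := h.hq; have hq' := h.hq'; have hs := h.hs; have hs2 := h.hs2; have hρ := h.hρ
    have hR0 : (0 : ℤ) ≤ R' := by positivity
    have hW0 : (0 : ℤ) ≤ WM := by positivity
    have hNR : (0 : ℤ) ≤ (N : ℤ) * R' := by positivity
    obtain ⟨eα, eβ, eW⟩ := eF 1 le_rfl
    rw [core, eα, eβ, eW, regionR, Adv.regionR, if_pos rfl, Adv.ρ₀]
    push_cast
    exact sBox_mono hσ c (by linarith) (by linarith) (by unfold w₁; linarith)
  · rw [regionR, Adv.regionR_of_ne_zero hk0]
    exact core_succ_subset_region hσ c h hk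

/-- **All rooted regions lie in the prism** `{-(3q + s₁ + 2R') ≤ level ≤ q + (N+1) s₁, |trans| ≤ ρ}`. [cite: KozmaNitzan2024, §4 Lemma 11 (p. 22: Ω)] -/
theorem regionR_subset_prism {k : ℕ} (hk : k ≤ N) :
    regionR q s₁ ρ R' a σ c k ⊆ sBox a σ c (-(Adv.ρ₀ q s₁ R')) (q + ((N : ℤ) + 1) * s₁) ρ := by
  have hq := h.hq; have hs := h.hs; have hs2 := h.hs2
  have hR0 : (0 : ℤ) ≤ R' := by positivity
  have hs0 : 0 ≤ s₁ := by linarith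
  have hNs : (0 : ℤ) ≤ (N : ℤ) * s₁ := by positivity
  rw [regionR]
  by_cases hk0 : k = 0
  · subst hk0; rw [Adv.regionR, if_pos rfl]
    exact sBox_mono hσ c le_rfl (by nlinarith) le_rfl
  · have hk1 : 1 ≤ k := by omega
    rw [Adv.regionR, if_neg hk0, Adv.ρ₀]
    have hks : (k : ℤ) * s₁ ≤ (N : ℤ) * s₁ := mul_le_mul_of_nonneg_right (by exact_mod_cast hk) hs0
    have hks1 : s₁ ≤ (k : ℤ) * s₁ := by
      have : (1 : ℤ) * s₁ ≤ (k : ℤ) * s₁ := mul_le_mul_of_nonneg_right (by exact_mod_cast hk1) hs0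
      linarith
    exact sBox_mono hσ c (by linarith) (by linarith) le_rfl

end Band

end ChainPlanar

end Transplant

end Summit.CriticalPhenomena.PercolationContinuityZ3.Theorems

end
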